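import Literature.AnabelianGeometry.EtaleTheta.Discharge.Sec1CyclotomeModOfTate

/-!
# [EtTh] §1/§2: the ALL-LEVEL compatible family `mods M : CyclotomeMod l M` (`M ∈ ℕ≥1`) from the origin clauses —
# the one-line supplier of the binders `(mods, hmods)` / `τ` of the cell's [EtTh]-§2-at-the-model and L6 model chains

Mochizuki, *The étale theta function …* [EtTh], Publ. RIMS **45** (2009), §1 PRIMS PDF pp. 12–13 «`(Ẑ(1) ≅) Δ_Θ`»,
«`(Δ^tp_Y)^ell ≅ Ẑ(1)`»; §2 p. 46 «the natural isomorphism `μ_N ≅ (l·Δ_Θ) ⊗ (ℤ/Nℤ)`»; Cor. 2.19 (ii) p. 64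
[cite: MochizukiEtTh2009, Cor 2.19 (ii) p.64]; [IUTchII] Prop. 1.5 (kurims p. 29) «the index `M` of the projective system
varies multiplicatively among the elements of `ℕ≥1`» [claim: Mochizuki2012, status: disputed].  Layer L2 of the abc-iut cell,
seat abc-iut-w5-d187 (gen 3); PROOF-ONLY sequel of `Sec1CyclotomeModOfTate.lean` (existence at every level from the
Tate-module clauses) and `CyclotomeTowerOfLevels.lean` (coherence is free, Kőnig).  Nothing of another seat is restated.

PURPOSE.  Some fifty landed files of the cell (abc-iut-w4-d043's [IUTchII] Cor. 1.12 (ii) model chain, abc-iut-w4-d030/w4-d038's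
Prop. 1.5 natural system, abc-iut-w4-d007's Prop. 3.1 (ii) record, the `BadPrimeGaussianMonoids…OfTower` files, abc-iut-L2's
`Sec2ModelCor219*` / `Sec2Cor218ivAllLevels`, …) bind the cyclotome data in the ALL-LEVEL shape
`(mods : ∀ M : ℕ+, D.CyclotomeMod l M) (hmods : ∀ M M' (h : M ∣ M') x, MuN.red p M M' h ((mods M').red x) = (mods M).red x)`
(GAP-LEDGER row G-L2t10-1).  This file states the SUPPLIER in exactly that shape:
* `exists_compatible_cyclotomeMods_of_isTateOrigin` — from `IsEtThOrigin`, `IsTateOrigin`, `hYcl`, `Δ_Θ` compact, `(Π^tp_X)^Θ` T2,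
  `l ≠ 0`;
* `exists_compatible_cyclotomeMods_of_origins` — from `IsEtThOrigin`, `IsThm16Origin` (R3), `IsTateOrigin`, the §6 bundle
  `GroupLevelData`, `hYcl` (G-w4d021-2), `l ≠ 0`;
so a consumer writes `obtain ⟨mods, hmods⟩ := D.exists_compatible_cyclotomeMods_of_origins hO h16 hT d hYcl hl`.
HONEST FRAMING: the origin predicates are hypotheses (inhabited only at models); nothing of [EtTh] is asserted; no side is taken on
[IUTchIII] Cor. 3.12; typed ≠ proved elsewhere.
-/

noncomputable section

namespace Literature.AnabelianGeometry.EtaleTheta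

open Literature.AnabelianGeometry.SemiGraphs
open _root_.Topology

namespace ThetaSetting

variable {p : ℕ} [Fact p.Prime] (D : ThetaSetting p)

/-- **The all-level compatible family `(mods, hmods)` from `IsTateOrigin`** (+ `IsEtThOrigin`, `hYcl`, `Δ_Θ` compact,
`(Π^tp_X)^Θ` Hausdorff, `l ≠ 0`): levelwise existence (`nonempty_cyclotomeMod_of_isTateOrigin`) + Kőnig
(`CyclotomeMod.exists_compatible_family_of_forall_nonempty`). [cite: MochizukiEtTh2009, Cor 2.19 (ii) p.64] -/
theorem exists_compatible_cyclotomeMods_of_isTateOrigin (hO : D.IsEtThOrigin) (hT : D.IsTateOrigin)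
    (hYcl : (D.DtpY.map D.toHat.toMonoidHom).topologicalClosure ≤
      D.DtpY.map D.toHat.toMonoidHom ⊔ (⁅⁅D.DeltaHat, D.DeltaHat⁆, D.DeltaHat⁆).topologicalClosure)
    (hΔ : IsCompact (D.DeltaTheta : Set D.GtpTheta)) [T2Space D.GtpTheta] {l : ℕ} (hl : l ≠ 0) :
    ∃ mods : ∀ M : ℕ+, D.CyclotomeMod l M,
      ∀ (M M' : ℕ+) (h : (M : ℕ) ∣ (M' : ℕ)) (x : D.lDeltaTheta l),
        MuN.red p M M' h ((mods M').red x) = (mods M).red x :=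
  CyclotomeMod.exists_compatible_family_of_forall_nonempty
    (fun N => D.nonempty_cyclotomeMod_of_isTateOrigin hO hT hYcl hΔ hl N)

/-- **The all-level compatible family `(mods, hmods)` from the ORIGIN CLAUSES**: `IsEtThOrigin` (F-2498), `IsThm16Origin`
(R3), `IsTateOrigin`, the §6 parameter bundle, `hYcl` (G-w4d021-2), `l ≠ 0` — the binder of GAP-LEDGER row G-L2t10-1 in
the ALL-LEVEL shape of [IUTchII] Prop. 1.5. [cite: MochizukiEtTh2009, Cor 2.19 (ii) p.64] -/
theorem exists_compatible_cyclotomeMods_of_origins (hO : D.IsEtThOrigin) (h16 : D.IsThm16Origin)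
    (hT : D.IsTateOrigin) (d : D.toTemperedCurve.GroupLevelData)
    (hYcl : (D.DtpY.map D.toHat.toMonoidHom).topologicalClosure ≤
      D.DtpY.map D.toHat.toMonoidHom ⊔ (⁅⁅D.DeltaHat, D.DeltaHat⁆, D.DeltaHat⁆).topologicalClosure)
    {l : ℕ} (hl : l ≠ 0) :
    ∃ mods : ∀ M : ℕ+, D.CyclotomeMod l M,
      ∀ (M M' : ℕ+) (h : (M : ℕ) ∣ (M' : ℕ)) (x : D.lDeltaTheta l),
        MuN.red p M M' h ((mods M').red x) = (mods M).red x :=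
  CyclotomeMod.exists_compatible_family_of_forall_nonempty
    (fun N => D.nonempty_cyclotomeMod_of_origins hO h16 hT d hYcl hl N)

/-- The same with explicit temperedness / first-countability of `Π^tp_X` and R3 as `IsQuotientMap toTheta` (no §6 bundle,
no `IsThm16Origin`). [cite: MochizukiEtTh2009, Cor 2.19 (ii) p.64] -/
theorem exists_compatible_cyclotomeMods_of_isTateOrigin_of_isQuotientMap (hO : D.IsEtThOrigin) (hT : D.IsTateOrigin)
    (hYcl : (D.DtpY.map D.toHat.toMonoidHom).topologicalClosure ≤
      D.DtpY.map D.toHat.toMonoidHom ⊔ (⁅⁅D.DeltaHat, D.DeltaHat⁆, D.DeltaHat⁆).topologicalClosure)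
    (hT' : IsTempered D.PiTemp) [FirstCountableTopology D.PiTemp] (hq : IsQuotientMap D.toTheta) {l : ℕ}
    (hl : l ≠ 0) :
    ∃ mods : ∀ M : ℕ+, D.CyclotomeMod l M,
      ∀ (M M' : ℕ+) (h : (M : ℕ) ∣ (M' : ℕ)) (x : D.lDeltaTheta l),
        MuN.red p M M' h ((mods M').red x) = (mods M).red x :=
  CyclotomeMod.exists_compatible_family_of_forall_nonempty
    (fun N => D.nonempty_cyclotomeMod_of_isTateOrigin_of_isQuotientMap hO hT hYcl hT' hq hl N)

end ThetaSetting

end Literature.AnabelianGeometry.EtaleTheta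

end
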